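import Literature.NumberTheory.EllipticCurves.Kato2004.IntegralH1CorestrictionMackey
import Summits.BirchSwinnertonDyer.BirchSwinnertonDyer.Theorems.ResidualThetaTransportAtTwoResidualSignedLambdaLowerCMAtTwoCofreeAdmissible
import Summits.BirchSwinnertonDyer.BirchSwinnertonDyer.Theorems.ResidualThetaTransportAtTwoResidualSignedLambdaLowerCMAtTwoCofreeLimitFamilyFloor
import Literature.NumberTheory.EllipticCurves.SubgroupSelmerCocycleCriteriaProofs
import Literature.NumberTheory.GaloisRepresentations.DecompositionGroupOfCompletion
import Literature.NumberTheory.GaloisRepresentations.IntegralGaloisActionProofs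
import HarnessLib

/-!
# Sketch (stub-ideation k3 g15, crux stmt-BirchSwinnertonDyer-26074, STUB `stub_cmLambdaLower` = RSL_g by name):
# the STRICT FLOOR of the split stub `stub_deepHalfAtTwoStrict` (S4₂, R12 item 6) — the `S₀`-STRICT levelwise solution sets
# are Cor-stable (double-coset Mackey for DECOMPOSITION groups, no floor, no unramifiedness), `[p]_*`-stable, finite with the
# admissible ones, and read back to `Λ`-adic strictness at EVERY layer; packaged as ONE call of the landed Kőnig consumer
# `exists_iwasawaH1_of_levelwise_from_of_finiteDimensional` (p687735) whose only remaining input is the levelwise SOCKET `hne`.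

TECHNIQUE (k = 3): decomposition of S4₂ into sub-stubs with a PROVED glue:
  S4₂  ⟸  SOCKET (`hne`, levelwise one-place Poitou–Tate lift: LEAD tp2-p2x `…DeepHalfAtTwoLevelwise`, in flight)
        + VALUE floor (p692412 §1/§3, landed) + ADMISSIBLE floor (p685876, landed) + STRICT floor (THIS FILE, §1–§4, proved)
        + the package §5 (THIS FILE, proved) + currency line `IsStrictAt ⟹ locd_S x = 0` (AwayTwo layer formula, LEAD pins).

* §1 `resLe_coresLe_eq_zero_of_conjFamily` — GENERIC continuous `H¹`: for `V ≤ U ≤ G`, `V` open of finite index in `U`, and a family of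
  subgroups `𝒟 : ι → Subgroup G` closed under `U`-conjugation (`g⁻¹ (𝒟 i) g ⊆ 𝒟 j`), a class of `H¹(V, X)` dying on every `V ⊓ 𝒟 j` has
  `cor_{U/V}` dying on every `U ⊓ 𝒟 i`.  The tree's `Kato2004.resLe_inertia_coresLe_eq_zero` (inertia groups) is the instance
  `𝒟 𝔓 = I_𝔓`; the NEW instance is `𝒟 𝔓 = D_𝔓 = MulAction.stabilizer Γ_ℚ 𝔓` (§2).  Same proof (vanishing form of the double-coset formula
  `resSubgroup_cores_eq_zero_of_doubleCoset`, NSW (1.5.6)–(1.5.7)), with `Ideal.conj_mem_inertia_smul_iff` replaced by the family hypothesis.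
* §2 `strict_layerCores` — for ANY `T : GaloisRep ℚ A M`, any `ℤ_p`-extension `κ`, any place `w`: Kato's trace `Cor : H¹(Γ_{n+1}, T) → H¹(Γ_n, T)`
  maps classes dying on every `Γ_{n+1} ⊓ D_𝔓` (`𝔓 ∣ w`) to classes dying on every `Γ_n ⊓ D_𝔓` — NO hypothesis on `w` (ramified, split or
  inert), in contrast with the inertia version `ThetaTransport.admissible_layerCores`, which needs `I_𝔓 ≤ Γ_{n+1}`.
* §3 `strict_cohomologyMap_cofreeTorsionPow` — `[p]_*`-stability (functoriality `resLe_cohomologyMap_cofreeTorsionPow`).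
* §4 `strict_of_forall_reduce` (= `ThetaTransport.resLe_inertia_eq_zero_of_forall_reduceH1CofreePkTorsion` with `I := D_𝔓`, by name) and
  `strict_proj_of_from` — strictness of `I.proj n x` for `n ≥ N₀` descends to ALL `n` (`I.cores_proj` + §2 at `T := T_ρ`).
* §5 `exists_iwasawaH1_strict_of_levelwise_from` — THE PACKAGE: for value sets `Val n k` stable under `[p]_*` and `Cor` (p692412 §3
  `valueCond_cohomologyMap_cofreeTorsionPow` / `valueCond_layerCores` in the instantiation) and the SOCKET
  `hne : ∀ j ≥ N₀, ∃ c ∈ Val j j, c admissible outside S' ∧ c strict at S₀`, ONE `x : I.H` with `red_{p^k}(proj_n x) ∈ Val n k` (`n ≥ N₀`),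
  STRICT at `S₀` at EVERY layer (`= IsStrictAt I S₀ x` of card k1-g9 §C, `Iff.rfl`) and unramified outside `S'` at every layer.

Credit / position: CofreeAdmissible (p685876, tp2-p2x g17) = the inertia twin of §2–§4; IntegralH1CorestrictionMackey (bsd-2adic-conv-1) = the
inertia instance of §1; k1-g9 §C = the predicate `IsStrictAt`; k3-g8 = the abstract S4d/S4b cut; STUB-PLAN rev 20 §3 item 7 names «the S-side
strictness» as REMAINING for S4₂ — this file is that piece, typed over the tree and proved.  BSD is NOT proved by any of this; RSL_g
(stmt-22608), (R≥)ᵖ (stmt-26074) and S4₂ are NOT proved here: the arithmetic of S4₂ is the hypothesis `hne`.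

References: [NeukirchSchmidtWingberg2008] I §5 (1.5.6)–(1.5.7), VIII §8.6; [Kato2004Asterisque] §8.2, Lemma 8.5, §12.2, §13.8;
[Rubin2000] App. B Prop. B.2.3, B.3.3; [MilneADT2006] I Thm. 4.10; [Greenberg1989] §1 (3).
-/

set_option autoImplicit false
set_option linter.dupNamespace false

noncomputable section

open scoped Classical NumberField Pointwise

namespace Summit.BirchSwinnertonDyer.BirchSwinnertonDyer.Cruxes.ResidualThetaCountLowerPureAtTwo.SideaK3G15

open CategoryTheory Field IsDedekindDomain Rat.HeightOneSpectrum
  Literature.NumberTheory.GaloisRepresentations Literature.NumberTheory.EllipticCurves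
  Literature.NumberTheory.EllipticCurves.GreenbergSelmer Literature.NumberTheory.EllipticCurves.Kato2004
  ZpExtension Summit.BirchSwinnertonDyer.BirchSwinnertonDyer.Theorems.ThetaTransport

universe u v

/-! ## §1 Generic: `res_{U ⊓ 𝒟 i} (cor_{U/V} x) = 0` for a `U`-conjugation-closed family `𝒟` once `res_{V ⊓ 𝒟 j} x = 0` for all `j` -/

section Generic

variable {R : Type u} [Ring R] [TopologicalSpace R]
  {G : Type v} [Group G] [TopologicalSpace G] [IsTopologicalGroup G]

/-- **Corestriction preserves vanishing on a conjugation-closed family of subgroups** (vanishing form of the double-coset formula,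
NSW (1.5.6)–(1.5.7)).  `V ≤ U ≤ G`, `V` open of finite index in `U`; `𝒟 : ι → Subgroup G` with `g⁻¹ (𝒟 i) g ⊆ 𝒟 j(g,i)` for `g ∈ U`;
if `x ∈ H¹(V, X)` dies on every `V ⊓ 𝒟 j` then `cor_{U/V} x` dies on every `U ⊓ 𝒟 i`.  Proof = the tree's
`Kato2004.resLe_inertia_coresLe_eq_zero` with `Ideal.conj_mem_inertia_smul_iff` replaced by `hconj`.
[cite: NeukirchSchmidtWingberg2008, I §5 (1.5.6)–(1.5.7)] -/
theorem resLe_coresLe_eq_zero_of_conjFamily (X : TopRep.{v} R G) {V U : Subgroup G} (h : V ≤ U)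
    (hV : IsOpen (V : Set G)) [Fintype (U ⧸ V.subgroupOf U)] {ι : Type*} (𝒟 : ι → Subgroup G)
    (hconj : ∀ g : G, g ∈ U → ∀ i : ι, ∃ j : ι, ∀ a : G, a ∈ 𝒟 i → g⁻¹ * a * g ∈ 𝒟 j)
    {x : continuousCohomology 1 (subgroupRep X V)}
    (hx : ∀ j : ι, resLe X (inf_le_left : V ⊓ 𝒟 j ≤ V) 1 x = 0) (i : ι) :
    resLe X (inf_le_left : U ⊓ 𝒟 i ≤ U) 1 (coresLe X h hV x) = 0 := by
  classical
  obtain ⟨φ, rfl⟩ := oneCocycleClass_surjective _ x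
  -- everything inside `U`: `N = V`, `D = U ∩ 𝒟 i` as subgroups of `U`
  let XU := subgroupRep X U
  let N : Subgroup U := V.subgroupOf U
  let D : Subgroup U := (U ⊓ 𝒟 i).subgroupOf U
  haveI : Finite (DoubleCoset.Quotient (D : Set U) N) := finite_doubleCosetQuotient N D
  letI : Fintype (DoubleCoset.Quotient (D : Set U) N) := Fintype.ofFinite _
  letI : ∀ q : DoubleCoset.Quotient (D : Set U) N, Fintype (D ⧸ (interConj N D q.out).subgroupOf D) :=
    fun q ↦ @Fintype.ofFinite _ (finite_quotient_interConj_subgroupOf N D q.out)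
  -- representatives of `U ⧸ V`
  have hs : ∀ y : U ⧸ N, ((Quotient.out y : U) : U ⧸ N) = y := fun y ↦ QuotientGroup.out_eq' y
  -- the pulled-back cocycle on `N = V.subgroupOf U`
  let φ' : contOneCocycles (subgroupRep XU N) :=
    contOneCocycles.pullback (subgroupOfHom h) (Y := subgroupRep XU N)
      (TopRep.ofHom ⟨ContinuousLinearMap.id R X, fun _ => rfl⟩) φ
  -- Mackey: `res_D (cor [φ']) = 0` inside `U`
  have hvan : resSubgroup XU D 1 (cores XU N (isOpen_subgroupOf U hV) (oneCocycleClass _ φ')) = 0 := by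
    refine resSubgroup_cores_eq_zero_of_doubleCoset N D XU (isOpen_subgroupOf U hV) _ fun q ↦ ?_
    set g : U := q.out with hg
    -- the hypothesis at the conjugate member `𝒟 j ⊇ g⁻¹ (𝒟 i) g`
    obtain ⟨j, hj⟩ := hconj (g : G) g.2 i
    have h0 := hx j
    rw [resLe_oneCocycleClass, oneCocycleClass_eq_zero_iff] at h0
    obtain ⟨w, hw⟩ := h0
    rw [conjRes_oneCocycleClass, oneCocycleClass_eq_zero_iff]
    refine ⟨X.ρ (g : G) w, fun a ↦ ?_⟩
    have ha := (mem_interConj N D (g : U) (a : U)).mp a.2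
    have haI : ((a : U) : G) ∈ 𝒟 i := (Subgroup.mem_subgroupOf.mp ha.1).2
    have hbV : (g : G)⁻¹ * ((a : U) : G) * (g : G) ∈ V := by
      have h' := Subgroup.mem_subgroupOf.mp ha.2
      simpa only [Subgroup.coe_mul, Subgroup.coe_inv] using h'
    have hbI : (g : G)⁻¹ * ((a : U) : G) * (g : G) ∈ 𝒟 j := hj _ haI
    have key : φ.1 (subgroupInclusion inf_le_left ⟨(g : G)⁻¹ * ((a : U) : G) * (g : G), hbV, hbI⟩) =
        X.ρ ((g : G)⁻¹ * ((a : U) : G) * (g : G)) w - w :=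
      hw ⟨(g : G)⁻¹ * ((a : U) : G) * (g : G), hbV, hbI⟩
    have harg : subgroupOfHom h (conjResHom N (g : U) (interConj N D (g : U)) (fun _ ha ↦ ha.2) a) =
        subgroupInclusion inf_le_left ⟨(g : G)⁻¹ * ((a : U) : G) * (g : G), hbV, hbI⟩ := by
      apply Subtype.ext
      rw [subgroupOfHom_apply_coe, conjResHom_apply_coe, subgroupInclusion_apply_coe]
      simp only [Subgroup.coe_mul, Subgroup.coe_inv]
    rw [conjRes_pullback_apply]
    change X.ρ ((g : U) : G) (φ.1 (subgroupOfHom h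
        (conjResHom N (g : U) (interConj N D (g : U)) (fun _ ha ↦ ha.2) a))) =
      X.ρ ((a : U) : G) (X.ρ ((g : U) : G) w) - X.ρ ((g : U) : G) w
    rw [harg, key, map_sub, ← ρ_mul_apply, ← ρ_mul_apply]
    congr 2
    group
  -- back to `resLe`/`coresLe` inside `G`
  rw [coresLe_oneCocycleClass X h hV hs φ]
  rw [cores_oneCocycleClass _ _ _ hs] at hvan
  exact resLe_eq_zero_of_resSubgroup_subgroupOf_eq_zero X inf_le_left hvan

/-- The INERTIA instance (`𝒟 𝔓 = I_𝔓`, indexed by all ideals of a `G`-ring `B`): recovers the tree's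
`Kato2004.resLe_inertia_coresLe_eq_zero` from §1 (`Ideal.conj_mem_inertia_smul_iff`). [cite: NeukirchSchmidtWingberg2008, I §5 (1.5.7)] -/
theorem resLe_inertia_coresLe_eq_zero' (X : TopRep.{v} R G) {V U : Subgroup G} (h : V ≤ U)
    (hV : IsOpen (V : Set G)) [Fintype (U ⧸ V.subgroupOf U)] {B : Type*} [CommRing B] [MulSemiringAction G B] (𝔓 : Ideal B)
    {x : continuousCohomology 1 (subgroupRep X V)}
    (hx : ∀ 𝔔 : Ideal B, resLe X (inf_le_left : V ⊓ 𝔔.inertia G ≤ V) 1 x = 0) :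
    resLe X (inf_le_left : U ⊓ 𝔓.inertia G ≤ U) 1 (coresLe X h hV x) = 0 :=
  resLe_coresLe_eq_zero_of_conjFamily X h hV (fun 𝔔 : Ideal B ↦ 𝔔.inertia G)
    (fun g _ 𝔔 ↦ ⟨g⁻¹ • 𝔔, fun a ha ↦ by simpa using (Ideal.conj_mem_inertia_smul_iff 𝔔 g⁻¹ a).mpr ha⟩) hx 𝔓

/-- The DECOMPOSITION instance (`𝒟 b = Stab_G(b)` for a `G`-set `β`, indexed by a `U`-stable subset `P`, e.g. `P = w.primesAbove`):
`cor_{U/V}` maps classes dying on every `V ⊓ Stab(b')`, `b' ∈ P`, to classes dying on every `U ⊓ Stab(b)`, `b ∈ P` — since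
`g⁻¹ Stab(b) g = Stab(g⁻¹ • b)`. [cite: NeukirchSchmidtWingberg2008, I §5 (1.5.6)–(1.5.7)] -/
theorem resLe_stabilizer_coresLe_eq_zero (X : TopRep.{v} R G) {V U : Subgroup G} (h : V ≤ U)
    (hV : IsOpen (V : Set G)) [Fintype (U ⧸ V.subgroupOf U)] {β : Type*} [MulAction G β] (P : Set β)
    (hP : ∀ g : G, g ∈ U → ∀ b ∈ P, g⁻¹ • b ∈ P)
    {x : continuousCohomology 1 (subgroupRep X V)}
    (hx : ∀ b ∈ P, resLe X (inf_le_left : V ⊓ MulAction.stabilizer G b ≤ V) 1 x = 0) {b : β} (hb : b ∈ P) :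
    resLe X (inf_le_left : U ⊓ MulAction.stabilizer G b ≤ U) 1 (coresLe X h hV x) = 0 :=
  resLe_coresLe_eq_zero_of_conjFamily X h hV (fun b' : P ↦ MulAction.stabilizer G (b' : β))
    (fun g hg b' ↦ ⟨⟨g⁻¹ • (b' : β), hP g hg _ b'.2⟩, fun a ha ↦ by
      rw [MulAction.mem_stabilizer_iff] at ha ⊢
      rw [mul_smul, mul_smul, smul_inv_smul, ha]⟩)
    (fun b' ↦ hx _ b'.2) ⟨b, hb⟩

end Generic

/-! ## §2 Kato's trace preserves «dies on every `Γ ⊓ D_𝔓`, `𝔓 ∣ w`» — any coefficients, any place, no floor -/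

section Layers

variable {A : Type} [CommRing A] [TopologicalSpace A] {M : Type} [AddCommGroup M] [Module A M]
  [TopologicalSpace M] [IsTopologicalAddGroup M] [ContinuousSMul A M] {p : ℕ} [Fact p.Prime]

/-- **`Cor : H¹(Γ_{n+1}, T) → H¹(Γ_n, T)` preserves strictness at `w`.**  For every `p`-adic representation `T` of `Γ_ℚ`, every
`ℤ_p`-extension `κ` and every finite place `w` (no hypothesis: `w` may ramify, split or stay inert in `ℚ_{n+1}/ℚ_n`): a class dying on
`Γ_{n+1} ⊓ D_𝔓` for every `𝔓 ∣ w` has trace dying on `Γ_n ⊓ D_𝔓` for every `𝔓 ∣ w` (`D_𝔓 = MulAction.stabilizer Γ_ℚ 𝔓`, the typing of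
`Kato2004.IsLocallyTrivialAt` and of card k1-g9's `IsStrictAt`).  §1 with `P = w.primesAbove` (`smul_mem_primesAbove`).
[cite: NeukirchSchmidtWingberg2008, I §5 (1.5.6)–(1.5.7)] [cite: Kato2004Asterisque, §8.2 (p. 181) and §12.2 (p. 220)] -/
theorem strict_layerCores (T : GaloisRep ℚ A M) (κ : ZpExtension ℚ p) (n : ℕ) (w : HeightOneSpectrum (𝓞 ℚ))
    {c : H1 T (κ.layerSubgroup (n + 1))}
    (hc : ∀ 𝔓 ∈ w.primesAbove, resLe T.toTopRep
      (inf_le_left : κ.layerSubgroup (n + 1) ⊓ MulAction.stabilizer (absoluteGaloisGroup ℚ) 𝔓 ≤ κ.layerSubgroup (n + 1)) 1 c = 0) :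
    ∀ 𝔓 ∈ w.primesAbove, resLe T.toTopRep
      (inf_le_left : κ.layerSubgroup n ⊓ MulAction.stabilizer (absoluteGaloisGroup ℚ) 𝔓 ≤ κ.layerSubgroup n) 1
        (layerCores T κ n c) = 0 := by
  intro 𝔓 h𝔓
  haveI : CompactSpace (absoluteGaloisGroup ℚ) := absoluteGaloisGroup_compactSpace ℚ
  haveI : (κ.layerSubgroup (n + 1)).FiniteIndex := finiteIndex_of_isOpen_of_compactSpace _ (κ.isOpen_layerSubgroup (n + 1))
  letI : Fintype (κ.layerSubgroup n ⧸ (κ.layerSubgroup (n + 1)).subgroupOf (κ.layerSubgroup n)) := Fintype.ofFinite _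
  unfold layerCores
  exact resLe_stabilizer_coresLe_eq_zero T.toTopRep (κ.layerSubgroup_antitone (Nat.le_succ n)) (κ.isOpen_layerSubgroup (n + 1))
    (w.primesAbove) (fun g _ 𝔔 h𝔔 ↦ smul_mem_primesAbove h𝔔 g⁻¹) hc h𝔓

/-- Iterating §2: strictness at `w` descends along `m` traces, `H¹(Γ_{n+m}, T) → H¹(Γ_n, T)`; used below the floor `N₀` in §4.
[cite: Kato2004Asterisque, §12.2 (p. 220)] -/
theorem strict_proj_of_from {κ : ZpExtension ℚ p} {T : GaloisRep ℚ A M} {γ : absoluteGaloisGroup ℚ}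
    (I : IwasawaH1DataCoeff T p κ γ) (w : HeightOneSpectrum (𝓞 ℚ)) (N₀ : ℕ) (x : I.H)
    (hx : ∀ n, N₀ ≤ n → ∀ 𝔓 ∈ w.primesAbove, resLe T.toTopRep
      (inf_le_left : κ.layerSubgroup n ⊓ MulAction.stabilizer (absoluteGaloisGroup ℚ) 𝔓 ≤ κ.layerSubgroup n) 1 (I.proj n x) = 0) :
    ∀ n, ∀ 𝔓 ∈ w.primesAbove, resLe T.toTopRep
      (inf_le_left : κ.layerSubgroup n ⊓ MulAction.stabilizer (absoluteGaloisGroup ℚ) 𝔓 ≤ κ.layerSubgroup n) 1 (I.proj n x) = 0 := by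
  have key : ∀ e n : ℕ, N₀ ≤ n + e → ∀ 𝔓 ∈ w.primesAbove, resLe T.toTopRep
      (inf_le_left : κ.layerSubgroup n ⊓ MulAction.stabilizer (absoluteGaloisGroup ℚ) 𝔓 ≤ κ.layerSubgroup n) 1 (I.proj n x) = 0 := by
    intro e
    induction e with
    | zero => intro n hn; exact hx n (by simpa using hn)
    | succ e ih =>
      intro n hn
      have h1 := ih (n + 1) (by omega)
      rw [← I.cores_proj n x]
      exact strict_layerCores T κ n w h1
  exact fun n ↦ key N₀ n (Nat.le_add_left N₀ n)

end Layers

/-! ## §3–§5 The framed representation `ρ : Γ_ℚ → GL_d(𝒪)`: `[p]_*`-stability, read-back, and the PACKAGE -/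

section Framed

variable {p : ℕ} [Fact p.Prime] (S : Set (PadicAlgCl p)) {d : ℕ} (ρ : FramedGaloisRep ℚ ↥(padicCoeffIntegers S) d)

/-- The `S₀`-STRICT classes of `H¹(U, A_ρ[N])`: dying on `U ⊓ D_𝔓` for every `𝔓 ∣ w ∈ S₀` (data: a `Set`). -/
def strictSet (N : ℤ) (S₀ : Finset (HeightOneSpectrum (𝓞 ℚ))) (U : Subgroup (absoluteGaloisGroup ℚ)) :
    Set (H1 (cofreeTorsionGaloisModule S ρ N) U) :=
  {c | ∀ w ∈ S₀, ∀ 𝔓 ∈ w.primesAbove, resLe (cofreeTorsionGaloisModule S ρ N).toTopRep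
    (inf_le_left : U ⊓ MulAction.stabilizer (absoluteGaloisGroup ℚ) 𝔓 ≤ U) 1 c = 0}

/-- The ADMISSIBLE classes of `H¹(U, A_ρ[N])` outside `S'`: dying on `U ⊓ I_𝔓` for every `𝔓 ∣ v ∉ S'` (the sets of `…CofreeAdmissible`). -/
def admSet (N : ℤ) (S' : Set (HeightOneSpectrum (𝓞 ℚ))) (U : Subgroup (absoluteGaloisGroup ℚ)) :
    Set (H1 (cofreeTorsionGaloisModule S ρ N) U) :=
  {c | ∀ v ∉ S', ∀ 𝔓 ∈ v.primesAbove, resLe (cofreeTorsionGaloisModule S ρ N).toTopRep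
    (inf_le_left : U ⊓ 𝔓.inertia (absoluteGaloisGroup ℚ) ≤ U) 1 c = 0}

/-- §3 **`[p]_*`-stability of the strict sets** (`resLe_cohomologyMap_cofreeTorsionPow`). [cite: Kato2004Asterisque, §13.8 (p. 228)] -/
theorem strict_cohomologyMap_cofreeTorsionPow (k : ℕ) (S₀ : Finset (HeightOneSpectrum (𝓞 ℚ))) (U : Subgroup (absoluteGaloisGroup ℚ))
    {c : H1 (cofreeTorsionGaloisModule S ρ ((p ^ (k + 1) : ℕ) : ℤ)) U}
    (hc : c ∈ strictSet S ρ ((p ^ (k + 1) : ℕ) : ℤ) S₀ U) :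
    cohomologyMap (subgroupRepMap (cofreeTorsionPow S ρ k) U) 1 c ∈ strictSet S ρ ((p ^ k : ℕ) : ℤ) S₀ U := by
  intro w hw 𝔓 h𝔓
  rw [resLe_cohomologyMap_cofreeTorsionPow, hc w hw 𝔓 h𝔓, map_zero]

/-- §2 for `A_ρ[N]`: **Cor-stability of the strict sets along the layers.** [cite: NeukirchSchmidtWingberg2008, I §5 (1.5.7)] -/
theorem strict_layerCores_cofree (N : ℤ) (κ : ZpExtension ℚ p) (S₀ : Finset (HeightOneSpectrum (𝓞 ℚ))) (n : ℕ)
    {c : H1 (cofreeTorsionGaloisModule S ρ N) (κ.layerSubgroup (n + 1))}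
    (hc : c ∈ strictSet S ρ N S₀ (κ.layerSubgroup (n + 1))) :
    layerCores (cofreeTorsionGaloisModule S ρ N) κ n c ∈ strictSet S ρ N S₀ (κ.layerSubgroup n) :=
  fun w hw ↦ strict_layerCores (cofreeTorsionGaloisModule S ρ N) κ n w (hc w hw)

/-- §4 **Strictness at `𝔓` is read on the reductions** (`𝒪` compact): `ThetaTransport.resLe_inertia_eq_zero_of_forall_reduceH1CofreePkTorsion`
with `I := D_𝔓` — that theorem is stated for an arbitrary subgroup. [cite: Rubin2000, App. B Prop. B.2.3] -/
theorem strict_of_forall_reduce [CompactSpace ↥(padicCoeffIntegers S)] (U : Subgroup (absoluteGaloisGroup ℚ))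
    (𝔓 : Ideal (absIntegers (𝓞 ℚ) ℚ)) (y : H1 (FramedGaloisRep.toGaloisRep ρ) U)
    (hy : ∀ k : ℕ, resLe (cofreeTorsionGaloisModule S ρ ((p ^ k : ℕ) : ℤ)).toTopRep
      (inf_le_left : U ⊓ MulAction.stabilizer (absoluteGaloisGroup ℚ) 𝔓 ≤ U) 1
      (reduceH1CofreePkTorsion S ρ k U y : H1 (cofreeTorsionGaloisModule S ρ ((p ^ k : ℕ) : ℤ)) U) = 0) :
    resLe (FramedGaloisRep.toGaloisRep ρ).toTopRep (inf_le_left : U ⊓ MulAction.stabilizer (absoluteGaloisGroup ℚ) 𝔓 ≤ U) 1 y = 0 :=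
  resLe_inertia_eq_zero_of_forall_reduceH1CofreePkTorsion S ρ U (MulAction.stabilizer (absoluteGaloisGroup ℚ) 𝔓) y hy

/-- §5 **THE PACKAGE — S4₂'s Kőnig call with the strict floor pre-assembled.**  On the newform habitat (`[FiniteDimensional ℚ_[p] ℚ_p(S)]`),
for the cyclotomic `κ`, a pinned `I`, a finite place set `S' ∋` the places over `p` (admissibility), ANY finite `S₀` (strictness), and VALUE
sets `Val n k ⊆ H¹(Γ_n, A_ρ[p^k])` stable under `[p]_*` and `Cor` above the floor `N₀`: if at every diagonal level `j ≥ N₀` SOME class is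
simultaneously in `Val j j`, admissible outside `S'` and strict at `S₀` (the SOCKET `hne` — the levelwise one-place Poitou–Tate lift of the
LEAD's `…DeepHalfAtTwoLevelwise`, composed with the orthogonality supply GLUE-67/(T)_ρ/T3♮), then ONE `x ∈ 𝐇¹(T_ρ)` has all its reductions
in the value sets above `N₀`, is STRICT at `S₀` at EVERY layer (card k1-g9's `IsStrictAt I S₀ x`, verbatim), and is unramified outside
`p` at every layer (`I.proj_mem`).  Engine: `exists_iwasawaH1_of_levelwise_from_of_finiteDimensional` (p687735) on `Sol := Val ∩ adm ∩ strict`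
(finite by `admissible_finite_layer`, stable by §2/§3 and `admissible_layerCores` / `admissible_cofreeTorsionPow`), then §4 and `I.proj_mem`.
[cite: Kato2004Asterisque, Lemma 8.5 (2) (p. 183), §12.2 (p. 220)] [cite: Rubin2000, App. B Prop. B.2.3, B.3.3] [cite: MilneADT2006, I Thm. 4.10] -/
theorem exists_iwasawaH1_strict_of_levelwise_from [FiniteDimensional ℚ_[p] ↥(padicCoeffField S)] {κ : ZpExtension ℚ p}
    (hκ : κ.IsCyclotomic) {γ : absoluteGaloisGroup ℚ} (I : IwasawaH1DataCoeff (FramedGaloisRep.toGaloisRep ρ) p κ γ) (N₀ : ℕ)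
    {S' : Set (HeightOneSpectrum (𝓞 ℚ))} (hS' : S'.Finite) (hSp : ∀ v : HeightOneSpectrum (𝓞 ℚ), (p : 𝓞 ℚ) ∈ v.asIdeal → v ∈ S')
    (S₀ : Finset (HeightOneSpectrum (𝓞 ℚ)))
    (Val : ∀ n k : ℕ, Set (H1 (cofreeTorsionGaloisModule S ρ ((p ^ k : ℕ) : ℤ)) (κ.layerSubgroup n)))
    (hVk : ∀ n k, N₀ ≤ n →
      ∀ c ∈ Val n (k + 1), cohomologyMap (subgroupRepMap (cofreeTorsionPow S ρ k) (κ.layerSubgroup n)) 1 c ∈ Val n k)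
    (hVn : ∀ n k, N₀ ≤ n →
      ∀ c ∈ Val (n + 1) k, layerCores (cofreeTorsionGaloisModule S ρ ((p ^ k : ℕ) : ℤ)) κ n c ∈ Val n k)
    (hne : ∀ j, N₀ ≤ j → ∃ c ∈ Val j j,
      c ∈ admSet S ρ ((p ^ j : ℕ) : ℤ) S' (κ.layerSubgroup j) ∧ c ∈ strictSet S ρ ((p ^ j : ℕ) : ℤ) S₀ (κ.layerSubgroup j)) :
    ∃ x : I.H,
      (∀ n k, N₀ ≤ n → (reduceH1CofreePkTorsion S ρ k (κ.layerSubgroup n) (I.proj n x) :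
          H1 (cofreeTorsionGaloisModule S ρ ((p ^ k : ℕ) : ℤ)) (κ.layerSubgroup n)) ∈ Val n k) ∧
      (∀ n, ∀ w ∈ S₀, ∀ 𝔓 ∈ w.primesAbove, resLe (FramedGaloisRep.toGaloisRep ρ).toTopRep
          (inf_le_left : κ.layerSubgroup n ⊓ MulAction.stabilizer (absoluteGaloisGroup ℚ) 𝔓 ≤ κ.layerSubgroup n) 1 (I.proj n x) = 0) ∧
      (∀ n, ∀ v : HeightOneSpectrum (𝓞 ℚ), ((primesEquiv v : Nat.Primes) : ℕ) ≠ p → ∀ 𝔓 ∈ v.primesAbove,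
          resLe (FramedGaloisRep.toGaloisRep ρ).toTopRep
            (inf_le_left : κ.layerSubgroup n ⊓ 𝔓.inertia (absoluteGaloisGroup ℚ) ≤ κ.layerSubgroup n) 1 (I.proj n x) = 0) := by
  haveI := UniversalNorms.compactSpace_padicCoeffIntegers S
  -- the solution sets: value ∩ admissible ∩ strict
  let Sol : ∀ n k : ℕ, Set (H1 (cofreeTorsionGaloisModule S ρ ((p ^ k : ℕ) : ℤ)) (κ.layerSubgroup n)) := fun n k ↦
    Val n k ∩ (admSet S ρ ((p ^ k : ℕ) : ℤ) S' (κ.layerSubgroup n) ∩ strictSet S ρ ((p ^ k : ℕ) : ℤ) S₀ (κ.layerSubgroup n))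
  have hfin : ∀ n k, N₀ ≤ n → (Sol n k).Finite := fun n k _ ↦
    (admissible_finite_layer S ρ κ k hS' n).subset fun c hc ↦ hc.2.1
  have hne' : ∀ j, N₀ ≤ j → (Sol j j).Nonempty := fun j hj ↦ by
    obtain ⟨c, hcV, hcA, hcS⟩ := hne j hj
    exact ⟨c, hcV, hcA, hcS⟩
  have hSk : ∀ n k, N₀ ≤ n → ∀ c ∈ Sol n (k + 1),
      cohomologyMap (subgroupRepMap (cofreeTorsionPow S ρ k) (κ.layerSubgroup n)) 1 c ∈ Sol n k :=
    fun n k hn c hc ↦ ⟨hVk n k hn c hc.1, admissible_cofreeTorsionPow S ρ k (κ.layerSubgroup n) hc.2.1,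
      strict_cohomologyMap_cofreeTorsionPow S ρ k S₀ (κ.layerSubgroup n) hc.2.2⟩
  have hSn : ∀ n k, N₀ ≤ n → ∀ c ∈ Sol (n + 1) k,
      layerCores (cofreeTorsionGaloisModule S ρ ((p ^ k : ℕ) : ℤ)) κ n c ∈ Sol n k :=
    fun n k hn c hc ↦ ⟨hVn n k hn c hc.1, admissible_layerCores S ρ _ κ hSp n hc.2.1,
      strict_layerCores_cofree S ρ _ κ S₀ n hc.2.2⟩
  obtain ⟨x, hx⟩ := exists_iwasawaH1_of_levelwise_from_of_finiteDimensional S ρ κ hκ I N₀ Sol hfin hne' hSk hSn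
  refine ⟨x, fun n k hn ↦ (hx n k hn).1, fun n w hw ↦ ?_, fun n v hv 𝔓 h𝔓 ↦ ?_⟩
  · -- strict at `S₀`: above the floor by §4 (read on the reductions), below it by §2 (traces)
    refine strict_proj_of_from I w N₀ x (fun m hm 𝔓 h𝔓 ↦ ?_) n
    exact strict_of_forall_reduce S ρ (κ.layerSubgroup m) 𝔓 (I.proj m x) fun k ↦ (hx m k hm).2.2 w hw 𝔓 h𝔓
  · -- unramified outside `p`: the pinned `𝐇¹` consists of integral families
    exact (mem_integralH1_iff (FramedGaloisRep.toGaloisRep ρ) p (κ.layerSubgroup n) (I.proj n x)).mp (I.proj_mem n x) v hv 𝔓 h𝔓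

/-- §5b **READBACK COMPANION of p692412 §4** (`DeepHalfTransfer.exists_iwasawaH1_locd₂_eq_of_levelwise_from[_of_finiteDimensional]`, whose
output is `∃ x, locd₂ x = z ∧ ∀ n k, N₀ ≤ n → red_{p^k}(proj_n x) ∈ Sol n k`): if the solution sets sit inside the strict sets above the floor,
the produced `x` is STRICT at `S₀` at EVERY layer (`IsStrictAt I S₀ x` of card k1-g9 §C verbatim) — §4 above the floor, §2 below it.  This is the
line the S4₂ proof writes right after the p692412 call, before the currency step `IsStrictAt ⟹ locd_S x = 0`.
[cite: Kato2004Asterisque, §12.2 (p. 220)] [cite: Rubin2000, App. B Prop. B.2.3] -/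
theorem strict_of_forall_reduce_proj_mem_from [CompactSpace ↥(padicCoeffIntegers S)] {κ : ZpExtension ℚ p}
    {γ : absoluteGaloisGroup ℚ} (I : IwasawaH1DataCoeff (FramedGaloisRep.toGaloisRep ρ) p κ γ) (N₀ : ℕ)
    (S₀ : Finset (HeightOneSpectrum (𝓞 ℚ)))
    (Sol : ∀ n k : ℕ, Set (H1 (cofreeTorsionGaloisModule S ρ ((p ^ k : ℕ) : ℤ)) (κ.layerSubgroup n)))
    (hSol : ∀ n k, N₀ ≤ n → Sol n k ⊆ strictSet S ρ ((p ^ k : ℕ) : ℤ) S₀ (κ.layerSubgroup n)) (x : I.H)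
    (hx : ∀ n k, N₀ ≤ n → (reduceH1CofreePkTorsion S ρ k (κ.layerSubgroup n) (I.proj n x) :
        H1 (cofreeTorsionGaloisModule S ρ ((p ^ k : ℕ) : ℤ)) (κ.layerSubgroup n)) ∈ Sol n k) :
    ∀ n, ∀ w ∈ S₀, ∀ 𝔓 ∈ w.primesAbove, resLe (FramedGaloisRep.toGaloisRep ρ).toTopRep
      (inf_le_left : κ.layerSubgroup n ⊓ MulAction.stabilizer (absoluteGaloisGroup ℚ) 𝔓 ≤ κ.layerSubgroup n) 1 (I.proj n x) = 0 := by
  intro n w hw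
  refine strict_proj_of_from I w N₀ x (fun m hm 𝔓 h𝔓 ↦ ?_) n
  exact strict_of_forall_reduce S ρ (κ.layerSubgroup m) 𝔓 (I.proj m x) fun k ↦ hSol m k hm (hx m k hm) w hw 𝔓 h𝔓

/-- §5c The three stabilities of `Sol := Val ∩ adm ∩ strict` in ONE lemma each (what p692412 §4's `hSk` / `hSn` binders receive).
[cite: Kato2004Asterisque, §13.8 (p. 228)] -/
theorem sol_cohomologyMap_cofreeTorsionPow (k : ℕ) {S' : Set (HeightOneSpectrum (𝓞 ℚ))} (S₀ : Finset (HeightOneSpectrum (𝓞 ℚ)))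
    (U : Subgroup (absoluteGaloisGroup ℚ)) {c : H1 (cofreeTorsionGaloisModule S ρ ((p ^ (k + 1) : ℕ) : ℤ)) U}
    (hc : c ∈ admSet S ρ ((p ^ (k + 1) : ℕ) : ℤ) S' U ∩ strictSet S ρ ((p ^ (k + 1) : ℕ) : ℤ) S₀ U) :
    cohomologyMap (subgroupRepMap (cofreeTorsionPow S ρ k) U) 1 c ∈
      admSet S ρ ((p ^ k : ℕ) : ℤ) S' U ∩ strictSet S ρ ((p ^ k : ℕ) : ℤ) S₀ U :=
  ⟨admissible_cofreeTorsionPow S ρ k U hc.1, strict_cohomologyMap_cofreeTorsionPow S ρ k S₀ U hc.2⟩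

/-- §5c (Cor). [cite: NeukirchSchmidtWingberg2008, I §5 (1.5.7)] [cite: Kato2004Asterisque, Lemma 8.5 (2) (p. 183)] -/
theorem sol_layerCores (N : ℤ) (κ : ZpExtension ℚ p) {S' : Set (HeightOneSpectrum (𝓞 ℚ))}
    (hSp : ∀ v : HeightOneSpectrum (𝓞 ℚ), (p : 𝓞 ℚ) ∈ v.asIdeal → v ∈ S') (S₀ : Finset (HeightOneSpectrum (𝓞 ℚ))) (n : ℕ)
    {c : H1 (cofreeTorsionGaloisModule S ρ N) (κ.layerSubgroup (n + 1))}
    (hc : c ∈ admSet S ρ N S' (κ.layerSubgroup (n + 1)) ∩ strictSet S ρ N S₀ (κ.layerSubgroup (n + 1))) :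
    layerCores (cofreeTorsionGaloisModule S ρ N) κ n c ∈ admSet S ρ N S' (κ.layerSubgroup n) ∩ strictSet S ρ N S₀ (κ.layerSubgroup n) :=
  ⟨admissible_layerCores S ρ N κ hSp n hc.1, strict_layerCores_cofree S ρ N κ S₀ n hc.2⟩

/-- §5c (finite). [cite: Rubin2000, App. B Prop. B.2.7] -/
theorem sol_finite [CompactSpace ↥(padicCoeffIntegers S)] (κ : ZpExtension ℚ p) (k : ℕ) {S' : Set (HeightOneSpectrum (𝓞 ℚ))}
    (hS' : S'.Finite) (S₀ : Finset (HeightOneSpectrum (𝓞 ℚ))) (n : ℕ)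
    (Val : Set (H1 (cofreeTorsionGaloisModule S ρ ((p ^ k : ℕ) : ℤ)) (κ.layerSubgroup n))) :
    (Val ∩ (admSet S ρ ((p ^ k : ℕ) : ℤ) S' (κ.layerSubgroup n) ∩ strictSet S ρ ((p ^ k : ℕ) : ℤ) S₀ (κ.layerSubgroup n))).Finite :=
  (admissible_finite_layer S ρ κ k hS' n).subset fun _ hc ↦ hc.2.1

/-! ## §6 DIALECT seam (sub-stub DIAL, proved): the socket's Greenberg–Vatsal output «`conj_σ c` dies on `Γ ⊓ D_w` for all `σ`»
(E1b `resOfLe_decomp_conjH1_eq_zero_of_localization_shapiroLift_eq_zero`, TP2's `[bad]` clause) ⟹ Kato's «`c` dies on `Γ ⊓ D_𝔓` for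
every `𝔓 ∣ w`» (= membership in `strictSet`, the typing of `Kato2004.IsLocallyTrivialAt` / k1-g9 `IsStrictAt`). -/

/-- **Conjugation transport of «dies on a subgroup»** (pure group cohomology, `H` normal): if `conj_σ c` dies on `H ⊓ D`
(Greenberg–Vatsal dialect `resOfLe ∘ conjH1`) and `σ D' σ⁻¹ ⊆ D`, then `c` dies on `H ⊓ D'` (Kato dialect `resLe`): with the witness `a` of
`σ • z(σ⁻¹ x σ) = x • a − a` on `H ⊓ D`, the witness on `H ⊓ D'` is `σ⁻¹ • a`. [cite: SerreGaloisCohomology1997, I §2.5 and §5.1] -/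
theorem resLe_inf_eq_zero_of_resOfLe_conjH1_eq_zero (N : ℤ) (H D D' : Subgroup (absoluteGaloisGroup ℚ)) [H.Normal]
    (σ : absoluteGaloisGroup ℚ) (hD : ∀ y : absoluteGaloisGroup ℚ, y ∈ D' → σ * y * σ⁻¹ ∈ D)
    (c : H1 (cofreeTorsionGaloisModule S ρ N) H)
    (h : resOfLe ↥(AddSubgroup.torsionBy (Cofree ρ ↥(padicCoeffField S)) N) (inf_le_left : H ⊓ D ≤ H)
      (conjH1 H ↥(AddSubgroup.torsionBy (Cofree ρ ↥(padicCoeffField S)) N) σ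
        (c : subgroupH1 H ↥(AddSubgroup.torsionBy (Cofree ρ ↥(padicCoeffField S)) N))) = 0) :
    resLe (cofreeTorsionGaloisModule S ρ N).toTopRep (inf_le_left : H ⊓ D' ≤ H) 1 c = 0 := by
  rw [resLe_inf_eq_zero_iff_resOfLe_inf_eq_zero]
  obtain ⟨z, rfl⟩ := oneCocycleClass_surjective (subgroupRep (cofreeTorsionGaloisModule S ρ N).toTopRep H) c
  change resOfLe ↥(AddSubgroup.torsionBy (Cofree ρ ↥(padicCoeffField S)) N) (inf_le_right : D' ⊓ H ≤ H)
    (oneCocycleClass (discreteTopRep H ↥(AddSubgroup.torsionBy (Cofree ρ ↥(padicCoeffField S)) N)) z) = 0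
  change resOfLe ↥(AddSubgroup.torsionBy (Cofree ρ ↥(padicCoeffField S)) N) (inf_le_left : H ⊓ D ≤ H)
    (conjH1 H _ σ (oneCocycleClass (discreteTopRep H ↥(AddSubgroup.torsionBy (Cofree ρ ↥(padicCoeffField S)) N)) z)) = 0 at h
  rw [CocycleCriteria.conjH1_oneCocycleClass_mem_ker_resOfLe_iff] at h
  obtain ⟨a, ha⟩ := h
  rw [CocycleCriteria.resOfLe_oneCocycleClass_eq_zero_iff]
  refine ⟨σ⁻¹ • a, fun y ↦ ?_⟩
  have hyD' : (y : absoluteGaloisGroup ℚ) ∈ D' := y.2.1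
  have hyH : (y : absoluteGaloisGroup ℚ) ∈ H := y.2.2
  have hxH : σ * (y : absoluteGaloisGroup ℚ) * σ⁻¹ ∈ H := Subgroup.Normal.conj_mem inferInstance _ hyH σ
  have hxD : σ * (y : absoluteGaloisGroup ℚ) * σ⁻¹ ∈ D := hD _ hyD'
  have key := ha ⟨σ * (y : absoluteGaloisGroup ℚ) * σ⁻¹, hxH, hxD⟩
  have hconj : subgroupConj H σ (Subgroup.inclusion (inf_le_left : H ⊓ D ≤ H) ⟨σ * (y : absoluteGaloisGroup ℚ) * σ⁻¹, hxH, hxD⟩) =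
      Subgroup.inclusion (inf_le_right : D' ⊓ H ≤ H) y := by
    apply Subtype.ext
    simp only [subgroupConj_apply_coe, Subgroup.coe_inclusion]
    group
  rw [hconj] at key
  -- `key : σ • z(y) = (σ y σ⁻¹) • a − a`; act by `σ⁻¹`
  have key' : z.1 (Subgroup.inclusion (inf_le_right : D' ⊓ H ≤ H) y) =
      σ⁻¹ • ((σ * (y : absoluteGaloisGroup ℚ) * σ⁻¹) • a - a) := by
    rw [← key, inv_smul_smul]
  rw [key', smul_sub, ← mul_smul, ← mul_smul]
  congr 2
  group

set_option synthInstance.maxHeartbeats 400000 in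
-- the pointwise action of `Γ_ℚ` on the ideals of `\bar ℤ` is found slowly (same remark as in `PrintCFram…SelmerToHomPrimes`)
/-- **DIAL: Greenberg–Vatsal `[strict]` ⟹ Kato `strictSet` at `w`.**  On a normal `H` (e.g. `Γ_n`): if `conj_σ c` dies on `H ⊓ D_w` for every
`σ ∈ Γ_ℚ` (`D_w = GreenbergSelmer.decomp w`, the output of E1b / the `[bad]`-type clause of a one-place Poitou–Tate lift), then `c` dies on
`H ⊓ D_𝔓` for EVERY prime `𝔓` of `\bar ℤ` above `w`: `D_w = D_{𝔓₀}` (`decompositionSubgroup_adicCompletionPrime_eq_range`), the primes above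
`w` are the `τ • 𝔓₀` (`exists_smul_eq_of_mem_primesAbove_holds`) and `D_{τ • 𝔓₀} = τ D_{𝔓₀} τ⁻¹`.
[cite: NeukirchANT1999, Ch. I §9 (9.1), (9.4); Ch. II §9 Prop. (9.6)] [cite: SerreGaloisCohomology1997, I §2.5] -/
theorem strictAt_of_forall_resOfLe_decomp_conjH1_eq_zero (N : ℤ) (H : Subgroup (absoluteGaloisGroup ℚ)) [H.Normal]
    (w : HeightOneSpectrum (𝓞 ℚ)) (c : H1 (cofreeTorsionGaloisModule S ρ N) H)
    (h : ∀ σ : absoluteGaloisGroup ℚ,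
      resOfLe ↥(AddSubgroup.torsionBy (Cofree ρ ↥(padicCoeffField S)) N) (inf_le_left : H ⊓ decomp (K := ℚ) w ≤ H)
        (conjH1 H ↥(AddSubgroup.torsionBy (Cofree ρ ↥(padicCoeffField S)) N) σ
          (c : subgroupH1 H ↥(AddSubgroup.torsionBy (Cofree ρ ↥(padicCoeffField S)) N))) = 0) :
    ∀ 𝔓 ∈ w.primesAbove, resLe (cofreeTorsionGaloisModule S ρ N).toTopRep
      (inf_le_left : H ⊓ MulAction.stabilizer (absoluteGaloisGroup ℚ) 𝔓 ≤ H) 1 c = 0 := by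
  intro 𝔓 h𝔓
  obtain ⟨τ, rfl⟩ := HeightOneSpectrum.exists_smul_eq_of_mem_primesAbove_holds (adicCompletionPrime_mem_primesAbove ℚ w) h𝔓
  refine resLe_inf_eq_zero_of_resOfLe_conjH1_eq_zero S ρ N H (decomp (K := ℚ) w) _ τ⁻¹ (fun y hy ↦ ?_) c (h τ⁻¹)
  -- `y ∈ D_{τ • 𝔓₀} ⟹ τ⁻¹ y τ ∈ D_{𝔓₀} = D_w`
  have hD : decomp (K := ℚ) w = (adicCompletionPrime ℚ w).decompositionSubgroup (absoluteGaloisGroup ℚ) := by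
    rw [decompositionSubgroup_adicCompletionPrime_eq_range]; rfl
  rw [hD, Ideal.mem_decompositionSubgroup_iff, inv_inv, mul_smul, mul_smul]
  rw [MulAction.mem_stabilizer_iff] at hy
  rw [hy, inv_smul_smul]

/-- DIAL for the layers and a finite `S₀`: the GV-dialect `[strict]` at every `w ∈ S₀` puts `c` in `strictSet` (the `Sol`-currency of §5).
[cite: NeukirchANT1999, Ch. II §9 Prop. (9.6)] -/
theorem mem_strictSet_of_forall_resOfLe_decomp_conjH1_eq_zero (N : ℤ) (κ : ZpExtension ℚ p) (n : ℕ)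
    (S₀ : Finset (HeightOneSpectrum (𝓞 ℚ))) (c : H1 (cofreeTorsionGaloisModule S ρ N) (κ.layerSubgroup n))
    (h : ∀ w ∈ S₀, ∀ σ : absoluteGaloisGroup ℚ,
      resOfLe ↥(AddSubgroup.torsionBy (Cofree ρ ↥(padicCoeffField S)) N) (inf_le_left : κ.layerSubgroup n ⊓ decomp (K := ℚ) w ≤ _)
        (conjH1 (κ.layerSubgroup n) ↥(AddSubgroup.torsionBy (Cofree ρ ↥(padicCoeffField S)) N) σ
          (c : subgroupH1 (κ.layerSubgroup n) ↥(AddSubgroup.torsionBy (Cofree ρ ↥(padicCoeffField S)) N))) = 0) :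
    c ∈ strictSet S ρ N S₀ (κ.layerSubgroup n) :=
  fun w hw ↦ strictAt_of_forall_resOfLe_decomp_conjH1_eq_zero S ρ N (κ.layerSubgroup n) w c (h w hw)


end Framed

end Summit.BirchSwinnertonDyer.BirchSwinnertonDyer.Cruxes.ResidualThetaCountLowerPureAtTwo.SideaK3G15

end
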